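import Mathlib
import HarnessLib
import Summits.ValiantsHypothesis.ValiantsHypothesis.Theses.FifoMatching
import Literature.Computability.AlgebraicComplexity.NestFreeMatchingPoly
import Summits.ValiantsHypothesis.ValiantsHypothesis.Theorems.DivisionGapZeroOneTransferSplit

/-!
# Crux `FifoMatching.NNNotVP` (stmt-ValiantsHypothesis-11615) — line `division-split` (skeleton)

Crux strategist, BC2 redirect (2026-08-17).  The deciding crux `NNNotVP` (the nest-free = FIFO
matching family `NN` is not a `VP_ℂ` family; at least as strong as `ValiantsHypothesis`) is
DECOMPOSED along the division gap of route `DivisionGap`: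

  `NNNotVP ⟸ ZeroOneTransfer ∧ NNDivisionHard`   (glue `nnNotVP_of_subs`, PROVED below),

where `ZeroOneTransfer` is the general 0/1-transfer (= `DivisionGap.ZeroOneTransfer`, item
stmt-ValiantsHypothesis-5066, verbatim) and `NNDivisionHard` (new piece) says that `NN_n` has
super-quasi-polynomial subtraction-free complexity WITH division, in the Hrubeš–Yehudayoff normal
form `min_{h ≠ 0} L₊(NN_n·h) + L₊(h)`.  The new piece gets its own skeleton through the BOOLEAN
TRANSFER (support functions): over `ℝ≥0` there is no cancellation, so `supp (f·h) = supp f + supp h`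
and a monotone computation of `f·h` decides, for every variable set `A`, whether `f·h` — hence
`f`, once a monomial of `h` lives inside `A` — has a monomial inside `A`; for `f = NN_n` this is
SHUFFLE-SQUARE RECOGNITION (the ordered graph `A` has a nest-free perfect matching), NP-complete.

Stubs (registered): `stub_zeroOneTransfer` (Z, the shared open transfer), `stub_supportFnHard`
(A: super-qp monotone complexity of every nonnegative polynomial with the support function of
`NN_n` with `≤ polylog n` arcs made free — the arithmetic form of a monotone Boolean circuit lower
bound for restricted shuffle-square), `stub_certificateToSupportFn` (B1, PROVABLE engine: a
certificate `NN_n·h` and a monomial `x^m` of `h` give a polynomial of no larger complexity with the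
support function of `NN_n|_{supp m := 1}`), `stub_spreadCofactorReduction` (B2, the open core
shared in kind with `DivisionGap.PerDivisionHard`: a cofactor can be traded, at quasi-polynomial
cost, for one having a monomial of polylog support).  Compositions (no sorry outside the stubs):
`nnDivisionHard_of : A → B1 → B2 → NNDivisionHard` (explicit hypotheses), the line's
`NNNotVP_of : NNNotVP` (the four stubs applied by name), and the glue stated on its own,
`nnNotVP_of_subs : Z → NNDivisionHard → NNNotVP` (explicit hypotheses = the two split children).
-/

noncomputable section

-- Sub = Summit single-conjunct layout: the duplicated namespace component is mandated by the tree.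
set_option linter.dupNamespace false

namespace Summit.ValiantsHypothesis.ValiantsHypothesis.Cruxes.NNNotVP.DivisionSplit

open MvPolynomial Literature.Computability.AlgebraicComplexity
open scoped NNReal BigOperators Classical

/-! ### Vocabulary of the line (abbreviations only; the ITEM statements stay inline) -/

/-- The variables of `NN_n`: ordered pairs of points of `Fin (2n)`. -/
abbrev σ (n : ℕ) : Type := Fin (2 * n) × Fin (2 * n)

/-- `NN_n` over `ℝ≥0` (library definition; definitionally the term inlined in the route file). -/
abbrev NN (n : ℕ) : MvPolynomial (σ n) ℝ≥0 := nestFreeMatchingPoly n ℝ≥0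

/-- The **support function** of a nonnegative polynomial `g` at a variable set `A`: some monomial
of `g` uses only variables of `A` (for `g = NN_n`: the ordered graph `A` has a nest-free perfect
matching = the word of `A` is a shuffle square).  It is exactly what a monotone computation of
`g`, read over the Boolean semiring, decides. -/
def SuppFn {τ : Type*} (g : MvPolynomial τ ℝ≥0) (A : Finset τ) : Prop :=
  ∃ m ∈ g.support, m.support ⊆ A

/-- Freeing the variables of `T`: the substitution `x_v := 1` for `v ∈ T` (a projection). -/
def freeVars {τ : Type*} (T : Finset τ) (g : MvPolynomial τ ℝ≥0) : MvPolynomial τ ℝ≥0 :=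
  MvPolynomial.aeval (fun v => if v ∈ T then (1 : MvPolynomial τ ℝ≥0) else X v) g

/-! ### The four registered stubs -/

/-- **Z — `ZeroOneTransfer`** (shared verbatim with `DivisionGap`, item stmt-ValiantsHypothesis-5066):
the general 0/1-transfer at quasi-polynomial rate.  OPEN (its own crux programme:
`Cruxes/ZeroOneTransfer/`). -/
theorem stub_zeroOneTransfer :
    ∀ (σ : ℕ → Type) [∀ n, Fintype (σ n)] (f : ∀ n, MvPolynomial (σ n) NNReal), (∀ n m, MvPolynomial.coeff m (f n) = 0 ∨ MvPolynomial.coeff m (f n) = 1) → Literature.Computability.AlgebraicComplexity.IsVPFamily (k := ℂ) (fun n => MvPolynomial.map (Complex.ofRealHom.comp NNReal.toRealHom) (f n)) → ∃ c : ℕ, ∀ n, ∃ h : MvPolynomial (σ n) NNReal, h ≠ 0 ∧ Literature.Computability.AlgebraicComplexity.complexity (f n * h) + Literature.Computability.AlgebraicComplexity.complexity h ≤ 2 ^ ((Nat.log 2 n + c) ^ c) := by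
  sorry

/-- **A — support-function hardness of `NN` with polylog free arcs** (arithmetic form of a
monotone Boolean circuit lower bound for restricted shuffle-square recognition): for all `k, c`,
for all large `n`, every `T` of `≤ (log₂ n + k)^k` arcs and every nonnegative `g` whose support
function is that of `NN_n|_{T := 1}` has `L₊(g) > 2^((log₂ n + c)^c)`.  OPEN; tools: the
approximation method (Razborov 1985, Alon–Boppana 1987; in tree `razborov_alon_boppana` for
CLIQUE), lifting; the target function is NP-complete (Buss–Soltys 2014). -/
theorem stub_supportFnHard :
    ∀ k c : ℕ, ∃ n₀ : ℕ, ∀ n ≥ n₀, ∀ T : Finset (σ n), T.card ≤ (Nat.log 2 n + k) ^ k →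
      ∀ g : MvPolynomial (σ n) ℝ≥0, (∀ A : Finset (σ n), SuppFn g A ↔ SuppFn (freeVars T (NN n)) A) →
        2 ^ ((Nat.log 2 n + c) ^ c) < complexity g := by
  sorry

/-- **B1 — a certificate computes a restricted support function** (PROVABLE engine): if `x^m` is a
monomial of `h`, then `g := (NN_n · h)|_{supp m := 1}` has the support function of
`NN_n|_{supp m := 1}` (no cancellation over `ℝ≥0`: `supp (f·h) = supp f + supp h`, and `h|_{supp m := 1}`
has a nonzero constant term) and `L₊(g) ≤ L₊(NN_n · h)` (a projection). -/
theorem stub_certificateToSupportFn :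
    ∀ (n : ℕ) (h : MvPolynomial (σ n) ℝ≥0), ∀ m ∈ h.support,
      ∃ g : MvPolynomial (σ n) ℝ≥0, (∀ A : Finset (σ n), SuppFn g A ↔ SuppFn (freeVars m.support (NN n)) A) ∧
        complexity g ≤ complexity (NN n * h) := by
  sorry

/-- **B2 — spread-cofactor reduction** (the OPEN core, the NN-form of Hrubeš–Yehudayoff's
Problem 2 difficulty): every nonzero cofactor `h` of `NN_n` can be traded for a cofactor `h'`
having a monomial of support `≤ (log₂ n + k)^k`, at a cost quasi-polynomial in `n` and in the
old certificate cost `L₊(NN_n h) + L₊(h)`. -/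
theorem stub_spreadCofactorReduction :
    ∃ k : ℕ, ∀ (n : ℕ) (h : MvPolynomial (σ n) ℝ≥0), h ≠ 0 →
      ∃ h' : MvPolynomial (σ n) ℝ≥0, (∃ m ∈ h'.support, m.support.card ≤ (Nat.log 2 n + k) ^ k) ∧
        complexity (NN n * h') ≤ 2 ^ ((Nat.log 2 n + Nat.log 2 (complexity (NN n * h) + complexity h) + k) ^ k) := by
  sorry

/-! ### Compositions (kernel-checked, no sorry) -/

/-- **A → B1 → B2 → `NNDivisionHard`** (the conclusion is verbatim the new piece's statement):
given `c`, take `k` from B2 and `C` from quasi-polynomial absorption; beyond the `n₀` of A at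
`(k, C)`, a certificate `L₊(NN_n h) + L₊(h) ≤ 2^((log₂ n + c)^c)` would give (B2) a cheap `NN_n h'`
whose cofactor has a monomial of polylog support, hence (B1) a cheap polynomial with the support
function of `NN_n` with those arcs freed — contradicting A. -/
theorem nnDivisionHard_of
    (hA : ∀ k c : ℕ, ∃ n₀ : ℕ, ∀ n ≥ n₀, ∀ T : Finset (σ n), T.card ≤ (Nat.log 2 n + k) ^ k →
      ∀ g : MvPolynomial (σ n) ℝ≥0, (∀ A : Finset (σ n), SuppFn g A ↔ SuppFn (freeVars T (NN n)) A) →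
        2 ^ ((Nat.log 2 n + c) ^ c) < complexity g)
    (hB1 : ∀ (n : ℕ) (h : MvPolynomial (σ n) ℝ≥0), ∀ m ∈ h.support,
      ∃ g : MvPolynomial (σ n) ℝ≥0, (∀ A : Finset (σ n), SuppFn g A ↔ SuppFn (freeVars m.support (NN n)) A) ∧
        complexity g ≤ complexity (NN n * h))
    (hB2 : ∃ k : ℕ, ∀ (n : ℕ) (h : MvPolynomial (σ n) ℝ≥0), h ≠ 0 →
      ∃ h' : MvPolynomial (σ n) ℝ≥0, (∃ m ∈ h'.support, m.support.card ≤ (Nat.log 2 n + k) ^ k) ∧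
        complexity (NN n * h') ≤ 2 ^ ((Nat.log 2 n + Nat.log 2 (complexity (NN n * h) + complexity h) + k) ^ k)) :
    ∀ c : ℕ, ∃ n₀ : ℕ, ∀ n ≥ n₀, ∀ h : MvPolynomial (Fin (2 * n) × Fin (2 * n)) NNReal, h ≠ 0 → 2 ^ ((Nat.log 2 n + c) ^ c) < Literature.Computability.AlgebraicComplexity.complexity ((∑ M : Fin (2 * n) → Fin (2 * n), if ((∀ i, M (M i) = i) ∧ (∀ i, M i ≠ i) ∧ ∀ i j, i < j → j < M j → M j < M i → False) then ∏ i : Fin (2 * n), (if i < M i then MvPolynomial.X (i, M i) else 1) else (0 : MvPolynomial (Fin (2 * n) × Fin (2 * n)) NNReal)) * h) + Literature.Computability.AlgebraicComplexity.complexity h := by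
  intro c
  obtain ⟨k, hk⟩ := hB2
  obtain ⟨C, hC⟩ := Summit.ValiantsHypothesis.ValiantsHypothesis.Theorems.DivisionGapZeroOneTransfer.Split.qp_absorb c k
  obtain ⟨n₀, hn₀⟩ := hA k C
  refine ⟨n₀, fun n hn h hh => ?_⟩
  -- the route's inline `NN_n` is definitionally the library's `nestFreeMatchingPoly n ℝ≥0`
  show 2 ^ ((Nat.log 2 n + c) ^ c) < complexity (NN n * h) + complexity h
  by_contra hle
  push Not at hle
  -- B2: a cheap certificate whose cofactor has a monomial of polylog support
  obtain ⟨h', ⟨m, hm, hcard⟩, hcost⟩ := hk n h hh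
  -- the old cost is `≤ 2^((log₂ n + c)^c)`, so its logarithm is `≤ (log₂ n + c)^c`
  have hlog : Nat.log 2 (complexity (NN n * h) + complexity h) ≤ (Nat.log 2 n + c) ^ c := by
    calc Nat.log 2 (complexity (NN n * h) + complexity h)
        ≤ Nat.log 2 (2 ^ ((Nat.log 2 n + c) ^ c)) := Nat.log_mono_right hle
      _ = (Nat.log 2 n + c) ^ c := Nat.log_pow (by norm_num) _
  have hcost' : complexity (NN n * h') ≤ 2 ^ ((Nat.log 2 n + C) ^ C) := by
    refine hcost.trans ?_
    refine Nat.pow_le_pow_right (by norm_num) ?_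
    refine le_trans ?_ (hC (Nat.log 2 n))
    exact Nat.pow_le_pow_left (by omega) k
  -- B1: a polynomial with the support function of `NN_n` with the arcs of `m` freed, no costlier
  obtain ⟨g, hg, hgc⟩ := hB1 n h' m hm
  -- A: such a polynomial is expensive
  have hlt := hn₀ n hn m.support hcard g hg
  exact absurd (lt_of_lt_of_le hlt (hgc.trans hcost')) (lt_irrefl _)

/-- **The line: the crux from the four registered stubs** (`Z`, `A`, `B1`, `B2` applied by name;
the composition is the glue `nnNotVP_of_subs` below with `NNDivisionHard := nnDivisionHard_of A B1 B2`,
inlined so that this hypothesis-free theorem is the first one concluding the crux BY NAME). -/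
theorem NNNotVP_of : Summit.ValiantsHypothesis.ValiantsHypothesis.Theses.FifoMatching.NNNotVP := by
  -- the new piece `NNDivisionHard` from its three stubs
  have hNN := nnDivisionHard_of stub_supportFnHard stub_certificateToSupportFn stub_spreadCofactorReduction
  -- the shared piece `ZeroOneTransfer`
  have hZ := stub_zeroOneTransfer
  -- the glue
  intro hVP
  have hcoeff : ∀ (n : ℕ) (m : (Fin (2 * n) × Fin (2 * n)) →₀ ℕ),
      MvPolynomial.coeff m (nestFreeMatchingPoly n NNReal) = 0 ∨
      MvPolynomial.coeff m (nestFreeMatchingPoly n NNReal) = 1 :=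
    fun n m => coeff_nestFreeMatchingPoly_eq_zero_or_eq_one n m
  have hmap : (fun n => MvPolynomial.map (Complex.ofRealHom.comp NNReal.toRealHom)
        (nestFreeMatchingPoly n NNReal)) = fun n => nestFreeMatchingPoly n ℂ := by
    funext n
    exact map_nestFreeMatchingPoly n _
  have hVP' : IsVPFamily (k := ℂ)
      (fun n => MvPolynomial.map (Complex.ofRealHom.comp NNReal.toRealHom)
        (nestFreeMatchingPoly n NNReal)) := by
    rw [hmap]
    exact hVP
  obtain ⟨c, hc⟩ := hZ (fun n => Fin (2 * n) × Fin (2 * n))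
    (fun n => nestFreeMatchingPoly n NNReal) hcoeff hVP'
  obtain ⟨n₀, hn₀⟩ := hNN c
  obtain ⟨h, hh, hle⟩ := hc n₀
  have hlt := hn₀ n₀ le_rfl h hh
  exact absurd (lt_of_lt_of_le hlt hle) (lt_irrefl _)

/-- **The glue of the split, stated on its own: `ZeroOneTransfer → NNDivisionHard → NNNotVP`**
(both hypotheses verbatim the piece statements = the two children of the intended
`route edit --split NNNotVP`; identical to the candidate Theorems file `FifoMatchingNNNotVPSplit.lean`).  If `NN ∈ VP_ℂ`, the transfer applied to `NN` over `ℝ≥0`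
(0/1 coefficients; complexification `= NN` over `ℂ`) bounds its division complexity by
`2^((log₂ n + c)^c)` for all `n`; hardness at this `c` exceeds it at `n = n₀`. -/
theorem nnNotVP_of_subs
    (h01 : ∀ (σ : ℕ → Type) [∀ n, Fintype (σ n)] (f : ∀ n, MvPolynomial (σ n) NNReal), (∀ n m, MvPolynomial.coeff m (f n) = 0 ∨ MvPolynomial.coeff m (f n) = 1) → Literature.Computability.AlgebraicComplexity.IsVPFamily (k := ℂ) (fun n => MvPolynomial.map (Complex.ofRealHom.comp NNReal.toRealHom) (f n)) → ∃ c : ℕ, ∀ n, ∃ h : MvPolynomial (σ n) NNReal, h ≠ 0 ∧ Literature.Computability.AlgebraicComplexity.complexity (f n * h) + Literature.Computability.AlgebraicComplexity.complexity h ≤ 2 ^ ((Nat.log 2 n + c) ^ c))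
    (hNN : ∀ c : ℕ, ∃ n₀ : ℕ, ∀ n ≥ n₀, ∀ h : MvPolynomial (Fin (2 * n) × Fin (2 * n)) NNReal, h ≠ 0 → 2 ^ ((Nat.log 2 n + c) ^ c) < Literature.Computability.AlgebraicComplexity.complexity ((∑ M : Fin (2 * n) → Fin (2 * n), if ((∀ i, M (M i) = i) ∧ (∀ i, M i ≠ i) ∧ ∀ i j, i < j → j < M j → M j < M i → False) then ∏ i : Fin (2 * n), (if i < M i then MvPolynomial.X (i, M i) else 1) else (0 : MvPolynomial (Fin (2 * n) × Fin (2 * n)) NNReal)) * h) + Literature.Computability.AlgebraicComplexity.complexity h) :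
    Summit.ValiantsHypothesis.ValiantsHypothesis.Theses.FifoMatching.NNNotVP := by
  intro hVP
  have hcoeff : ∀ (n : ℕ) (m : (Fin (2 * n) × Fin (2 * n)) →₀ ℕ),
      MvPolynomial.coeff m (nestFreeMatchingPoly n NNReal) = 0 ∨
      MvPolynomial.coeff m (nestFreeMatchingPoly n NNReal) = 1 :=
    fun n m => coeff_nestFreeMatchingPoly_eq_zero_or_eq_one n m
  have hmap : (fun n => MvPolynomial.map (Complex.ofRealHom.comp NNReal.toRealHom)
        (nestFreeMatchingPoly n NNReal)) = fun n => nestFreeMatchingPoly n ℂ := by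
    funext n
    exact map_nestFreeMatchingPoly n _
  have hVP' : IsVPFamily (k := ℂ)
      (fun n => MvPolynomial.map (Complex.ofRealHom.comp NNReal.toRealHom)
        (nestFreeMatchingPoly n NNReal)) := by
    rw [hmap]
    exact hVP
  obtain ⟨c, hc⟩ := h01 (fun n => Fin (2 * n) × Fin (2 * n))
    (fun n => nestFreeMatchingPoly n NNReal) hcoeff hVP'
  obtain ⟨n₀, hn₀⟩ := hNN c
  obtain ⟨h, hh, hle⟩ := hc n₀
  have hlt := hn₀ n₀ le_rfl h hh
  exact absurd (lt_of_lt_of_le hlt hle) (lt_irrefl _)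

end Summit.ValiantsHypothesis.ValiantsHypothesis.Cruxes.NNNotVP.DivisionSplit

end
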